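import Mathlib
import HarnessLib
import Summits.CriticalPhenomena.PercolationContinuityZ3.Theses.PercLowPointHalfSpace
import Literature.Probability.Percolation.HalfSpaceFloorDilution
import Literature.Probability.Percolation.UniversalTightness
import Literature.Probability.Percolation.SharpnessDCTProofs
import Literature.Probability.Percolation.PercolationProofs

/-!
# Two weaker-looking forms of the no-fat-half-box hypothesis B♯ (line SketchIdeator1, crux `LowPointBookkeeping`)

Helper file of line SketchIdeator1 (skeleton floor-russo) for the crux `LowPointBookkeeping`
(stmt-CriticalPhenomena-14713, route PercLowPointHalfSpace).  The canonical hypothesis-stub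
`stub_noFatHalfBoxOrigin` (B♯) reads: `P^{ℍ}_{p_c,1}(|K_max(B_n ∩ ℍ)| ≥ C n^{11/4}) ≤ e^{-1}` for all
`n ≥ 1`.  Two sufficient conditions, each of independent interest to a planner restating the route:

* `noFatHalfBoxOrigin_of_quantile` — **any quantile will do**: if for some `q < 1`,
  `P^{ℍ}_{p_c,1}(|K_max(B_n ∩ ℍ)| ≥ C n^{11/4}) ≤ q` for all `n ≥ 1`, then B♯ holds (with a larger
  constant): Hutchcroft's sub-multiplicativity `P(|K_max| ≥ (2N+1)t) ≤ P(|K_max| ≥ t)^{N+1}`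
  (`prodBernoulli_real_clusterMaxIn_ge_mul_le`).  So B♯ fails only if `|K_max(B_n ∩ ℍ)|/n^{11/4} → ∞`
  in probability along a subsequence ("fat clusters with high probability");
* `noFatHalfBoxOrigin_of_boxSusceptibility` — **a LINEAR sufficient condition**: the truncated
  half-space susceptibility bound `Σ_{y ∈ B_n ∩ ℍ} P_{p_c}(x ↔_ℍ y) ≤ C n^{5/2}` for all `x ∈ B_n ∩ ℍ`,
  `n ≥ 1` (real world `n^{2-η} ≈ n^{2.05}`) implies B♯, by the second-moment count
  `λ² 𝟙[|K_max(Λ)| ≥ λ] ≤ #{(x,y) ∈ Λ² : x ↔ y}` (`sq_mul_measureReal_le_sum`) and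
  `P^{ℍ}_{p_c,1}(x ↔ y) = P_{p_c}(x ↔_ℍ y)` (configurations live on half-space edges a.s.).

Registered wrappers: `stub_noFatOfQuantile`, `stub_noFatOfSusceptibility`.
-/

noncomputable section

open MeasureTheory Filter Topology
open Literature.Probability.Percolation Literature.Probability.LatticeModels
open scoped ENNReal Classical

namespace Summit.CriticalPhenomena.PercolationContinuityZ3.Theorems.FloorRusso.NoFatForms

/-- The critical bond percolation measure on `ℤ³` (local notation). -/
local notation3 (prettyPrint := false) "μc" =>
  (bondPercolation (zdGraph 3) (criticalProbI 3) : Measure (BondConfig (Site 3)))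

/-- The floor-diluted critical half-space measure at full floor density `s = 1` (local notation). -/
local notation3 (prettyPrint := false) "μ₁" =>
  (floorDilutedPercolation 3 (criticalProbI 3) 1 : Measure (BondConfig (Site 3)))

/-- The closed half-space `ℍ = {x₀ ≥ 0}` (local notation). -/
local notation3 (prettyPrint := false) "HS" => ({x : Site 3 | 0 ≤ x 0} : Set (Site 3))

/-- The half-box `Λ_n = B_n ∩ ℍ` (local notation). -/
local notation3 (prettyPrint := false) "Λ⟦" n "⟧" => ((box 3 n).filter fun z : Site 3 => 0 ≤ z 0)

/-! ### (1) Any quantile will do -/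

/-- **B♯ from any quantile `q < 1`.** -/
theorem noFatHalfBoxOrigin_of_quantile
    (h : ∃ C q : ℝ, 0 < C ∧ q < 1 ∧ ∀ n : ℕ, 1 ≤ n →
      (μ₁).real {ω | C * (n : ℝ) ^ ((11 : ℝ) / 4) ≤ (clusterMaxIn Λ⟦n⟧ ω : ℝ)} ≤ q) :
    ∃ C : ℝ, 0 < C ∧ ∀ n : ℕ, 1 ≤ n →
      (μ₁).real {ω | C * (n : ℝ) ^ ((11 : ℝ) / 4) ≤ (clusterMaxIn Λ⟦n⟧ ω : ℝ)} ≤ Real.exp (-1) := by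
  obtain ⟨C, q, hC, hq, h⟩ := h
  -- a power of `max q 0` below `e^{-1}`
  have hq0 : 0 ≤ max q 0 := le_max_right _ _
  have hq1 : max q 0 < 1 := max_lt hq one_pos
  obtain ⟨N, hN⟩ := exists_pow_lt_of_lt_one (Real.exp_pos (-1)) hq1
  refine ⟨(2 * N + 1) * (C + 1), by positivity, fun n hn => ?_⟩
  have hn1 : (1 : ℝ) ≤ n := by exact_mod_cast hn
  have hr1 : (1 : ℝ) ≤ (n : ℝ) ^ ((11 : ℝ) / 4) := Real.one_le_rpow hn1 (by norm_num)
  have hCr : 0 ≤ C * (n : ℝ) ^ ((11 : ℝ) / 4) := by positivity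
  -- integer threshold `t = ⌈C n^{11/4}⌉`
  obtain ⟨t, ht⟩ : ∃ t : ℕ, t = ⌈C * (n : ℝ) ^ ((11 : ℝ) / 4)⌉₊ := ⟨_, rfl⟩
  have ht1 : 1 ≤ t := by
    rw [ht, Nat.one_le_ceil_iff]
    exact mul_pos hC (by linarith)
  have htle : (t : ℝ) ≤ (C + 1) * (n : ℝ) ^ ((11 : ℝ) / 4) := by
    have := Nat.ceil_lt_add_one hCr
    rw [← ht] at this
    nlinarith
  -- the measure is a product Bernoulli measure
  have hμ : (μ₁) = prodBernoulli (floorDilutedParam 3 (criticalProbI 3) 1) := rfl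
  have key := prodBernoulli_real_clusterMaxIn_ge_mul_le (floorDilutedParam 3 (criticalProbI 3) 1)
    Λ⟦n⟧ (N := N) ht1
  rw [← hμ] at key
  -- `P(K_max ≥ t) ≤ max q 0`
  have hsmall : (μ₁).real {ω | t ≤ clusterMaxIn Λ⟦n⟧ ω} ≤ max q 0 := by
    refine le_trans (measureReal_mono (fun ω hω => ?_) (measure_ne_top _ _)) ((h n hn).trans (le_max_left _ _))
    simp only [Set.mem_setOf_eq] at hω ⊢
    have : (t : ℝ) ≤ clusterMaxIn Λ⟦n⟧ ω := by exact_mod_cast hω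
    exact le_trans (ht ▸ Nat.le_ceil _) this
  calc (μ₁).real {ω | (2 * N + 1) * (C + 1) * (n : ℝ) ^ ((11 : ℝ) / 4) ≤ (clusterMaxIn Λ⟦n⟧ ω : ℝ)}
      ≤ (μ₁).real {ω | (2 * N + 1) * t ≤ clusterMaxIn Λ⟦n⟧ ω} := by
        refine measureReal_mono (fun ω hω => ?_) (measure_ne_top _ _)
        simp only [Set.mem_setOf_eq] at hω ⊢
        have h1 : ((2 * N + 1 : ℕ) : ℝ) * t ≤ (2 * N + 1) * (C + 1) * (n : ℝ) ^ ((11 : ℝ) / 4) := by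
          push_cast; nlinarith
        exact_mod_cast h1.trans hω
    _ ≤ (μ₁).real {ω | t ≤ clusterMaxIn Λ⟦n⟧ ω} ^ (N + 1) := key
    _ ≤ (max q 0) ^ (N + 1) := pow_le_pow_left₀ measureReal_nonneg hsmall _
    _ ≤ (max q 0) ^ N := pow_le_pow_of_le_one hq0 hq1.le (Nat.le_succ N)
    _ ≤ Real.exp (-1) := hN.le

/-! ### (2) The linear (susceptibility) sufficient condition -/

/-- Counting lemma, lower-bound form: if on `B` at least `c` of the events `A_i` (`i ∈ s`) occur,
then `c · P(B) ≤ Σ_{i ∈ s} P(A_i ∩ B)`. -/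
theorem mul_measureReal_le_sum {Ω ι : Type*} [MeasurableSpace Ω] (μ : Measure Ω)
    [IsFiniteMeasure μ] (s : Finset ι) (A : ι → Set Ω) (B : Set Ω)
    (hA : ∀ i ∈ s, MeasurableSet (A i)) (hB : MeasurableSet B) {c : ℝ}
    (hcount : ∀ ω ∈ B, c ≤ ((s.filter fun i => ω ∈ A i).card : ℝ)) :
    c * μ.real B ≤ ∑ i ∈ s, μ.real (A i ∩ B) := by
  have h1 : ∀ i ∈ s, μ.real (A i ∩ B) =
      ∫ ω, (A i ∩ B).indicator (fun _ => (1 : ℝ)) ω ∂μ := fun i hi => by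
    rw [integral_indicator_const (1 : ℝ) ((hA i hi).inter hB), smul_eq_mul, mul_one]
  have h2 : c * μ.real B = ∫ ω, B.indicator (fun _ => c) ω ∂μ := by
    rw [integral_indicator_const c hB, smul_eq_mul, mul_comm]
  rw [Finset.sum_congr rfl h1, ← integral_finsetSum s fun i hi =>
    (integrable_const (1 : ℝ)).indicator ((hA i hi).inter hB), h2]
  refine integral_mono ((integrable_const c).indicator hB)
    (integrable_finsetSum s fun i hi => (integrable_const (1 : ℝ)).indicator ((hA i hi).inter hB))
    fun ω => ?_
  by_cases hω : ω ∈ B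
  · have : ∑ i ∈ s, (A i ∩ B).indicator (fun _ => (1 : ℝ)) ω =
        ((s.filter fun i => ω ∈ A i).card : ℝ) := by
      rw [Finset.card_filter]
      push_cast
      refine Finset.sum_congr rfl fun i _ => ?_
      by_cases hi : ω ∈ A i
      · rw [Set.indicator_of_mem (show ω ∈ A i ∩ B from ⟨hi, hω⟩), if_pos hi]
      · rw [Set.indicator_of_notMem (show ω ∉ A i ∩ B from fun h => hi h.1), if_neg hi]
    simp only
    rw [this, Set.indicator_of_mem hω]
    exact hcount ω hω
  · have : ∑ i ∈ s, (A i ∩ B).indicator (fun _ => (1 : ℝ)) ω = 0 :=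
      Finset.sum_eq_zero fun i _ => Set.indicator_of_notMem (fun h => hω h.2) _
    simp only
    rw [this, Set.indicator_of_notMem hω]

/-- On `{k ≤ |K_max(Λ)|}` at least `k²` ordered pairs of points of `Λ` are joined by open paths (the
pairs inside a maximal cluster trace). -/
theorem sq_le_card_pairs (Λ : Finset (Site 3)) (hΛ : Λ.Nonempty) (k : ℕ) (ω : BondConfig (Site 3))
    (hk : k ≤ clusterMaxIn Λ ω) :
    k ^ 2 ≤ ((Λ ×ˢ Λ).filter fun xy : Site 3 × Site 3 => ω ∈ openConn xy.1 xy.2).card := by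
  obtain ⟨v, _, hv⟩ := exists_clusterCapIn_eq_clusterMaxIn hΛ ω
  obtain ⟨T, hT⟩ : ∃ T : Finset (Site 3), T = Λ.filter fun z => (openGraph ω).Reachable v z := ⟨_, rfl⟩
  have hTcard : T.card = clusterMaxIn Λ ω := by rw [hT, hv, clusterCapIn_eq]
  have hsub : T ×ˢ T ⊆ (Λ ×ˢ Λ).filter fun xy : Site 3 × Site 3 => ω ∈ openConn xy.1 xy.2 := by
    intro xy hxy
    rw [Finset.mem_product] at hxy
    rw [hT, Finset.mem_filter, Finset.mem_filter] at hxy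
    obtain ⟨⟨hx, hvx⟩, hy, hvy⟩ := hxy
    exact Finset.mem_filter.2 ⟨Finset.mem_product.2 ⟨hx, hy⟩, hvx.symm.trans hvy⟩
  calc k ^ 2 ≤ T.card ^ 2 := Nat.pow_le_pow_left (hTcard ▸ hk) 2
    _ = (T ×ˢ T).card := by rw [Finset.card_product, sq]
    _ ≤ _ := Finset.card_le_card hsub

/-- **Second-moment bound**: `k² · P(|K_max(Λ)| ≥ k) ≤ Σ_{x,y ∈ Λ} P(x ↔ y)`, for any probability
measure on configurations. -/
theorem sq_mul_measureReal_le_sum (μ : Measure (BondConfig (Site 3))) [IsProbabilityMeasure μ]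
    (Λ : Finset (Site 3)) (hΛ : Λ.Nonempty) (k : ℕ) :
    (k : ℝ) ^ 2 * μ.real {ω | k ≤ clusterMaxIn Λ ω} ≤
      ∑ xy ∈ Λ ×ˢ Λ, μ.real (openConn xy.1 xy.2) := by
  calc (k : ℝ) ^ 2 * μ.real {ω | k ≤ clusterMaxIn Λ ω}
      ≤ ∑ xy ∈ Λ ×ˢ Λ, μ.real (openConn xy.1 xy.2 ∩ {ω | k ≤ clusterMaxIn Λ ω}) := by
        refine mul_measureReal_le_sum μ (Λ ×ˢ Λ) (fun xy : Site 3 × Site 3 => openConn xy.1 xy.2)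
          {ω | k ≤ clusterMaxIn Λ ω} (fun xy _ => measurableSet_openConn_holds xy.1 xy.2)
          (measurableSet_clusterMaxIn_ge Λ k) fun ω hω => ?_
        exact_mod_cast sq_le_card_pairs Λ hΛ k ω hω
    _ ≤ ∑ xy ∈ Λ ×ˢ Λ, μ.real (openConn xy.1 xy.2) :=
        Finset.sum_le_sum fun xy _ => measureReal_mono Set.inter_subset_left (measure_ne_top _ _)

/-- A configuration supported on half-space edges joins a point of `ℍ` to `y` only inside `ℍ`. -/
theorem mem_openConnIn_of_reachable {ω : BondConfig (Site 3)} (hω : ω ⊆ halfSpaceEdgeSet 3)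
    {x y : Site 3} (hx : x ∈ HS) (h : (openGraph ω).Reachable x y) : ω ∈ openConnIn HS x y := by
  rw [DCT16.mem_openConnIn_iff_pathIn]
  rw [SimpleGraph.reachable_iff_reflTransGen] at h
  have hrp : ∀ a b : Site 3, (openGraph ω).Adj a b → (openGraph ω).Adj a b ∧ b ∈ HS := by
    intro a b hab
    refine ⟨hab, ?_⟩
    rw [openGraph_adj] at hab
    exact (hω hab.1).2 b (Sym2.mem_mk_right a b)
  refine ⟨hx, ?_⟩
  induction h with
  | refl => exact Relation.ReflTransGen.refl
  | tail _ hbc ih => exact ih.tail (hrp _ _ hbc)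

/-- `P^{ℍ}_{p_c,1}(x ↔ y) ≤ P_{p_c}(x ↔_ℍ y)` for `x ∈ ℍ` (in fact equality; configurations lie on
half-space edges a.s., `floorDilutedPercolation_ae_subset`, then `floorDilutedPercolation_one_openConnIn`). -/
theorem real_openConn_le {x : Site 3} (hx : x ∈ HS) (y : Site 3) :
    (μ₁).real (openConn x y) ≤ (μc).real (openConnIn HS x y) := by
  have hae : (μ₁) {ω | ω ⊆ halfSpaceEdgeSet 3}ᶜ = 0 := by
    rw [← mem_ae_iff]
    exact floorDilutedPercolation_ae_subset (criticalProbI 3) 1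
  have hsub : (openConn x y : Set (BondConfig (Site 3))) ⊆
      openConnIn HS x y ∪ {ω | ω ⊆ halfSpaceEdgeSet 3}ᶜ := by
    intro ω hω
    by_cases hG : ω ⊆ halfSpaceEdgeSet 3
    · exact Or.inl (mem_openConnIn_of_reachable hG hx hω)
    · exact Or.inr hG
  have h1 : (μ₁) (openConn x y) ≤ (μ₁) (openConnIn HS x y) := by
    calc (μ₁) (openConn x y) ≤ (μ₁) (openConnIn HS x y ∪ {ω | ω ⊆ halfSpaceEdgeSet 3}ᶜ) :=
          measure_mono hsub
      _ ≤ (μ₁) (openConnIn HS x y) + (μ₁) {ω | ω ⊆ halfSpaceEdgeSet 3}ᶜ := measure_union_le _ _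
      _ = (μ₁) (openConnIn HS x y) := by rw [hae, add_zero]
  have h2 : (μ₁) (openConnIn HS x y) = (μc) (openConnIn HS x y) :=
    floorDilutedPercolation_one_openConnIn (criticalProbI 3) subset_rfl x y
  simp only [measureReal_def]
  rw [← h2]
  exact ENNReal.toReal_mono (measure_ne_top _ _) h1

/-- `|Λ_n| ≤ 27 n³` for `n ≥ 1`. -/
theorem card_halfBox_le {n : ℕ} (hn : 1 ≤ n) : ((Λ⟦n⟧).card : ℝ) ≤ 27 * (n : ℝ) ^ 3 := by
  have h1 : (Λ⟦n⟧).card ≤ (box 3 n).card := Finset.card_filter_le _ _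
  have h2 : ((box 3 n).card : ℝ) = (2 * (n : ℝ) + 1) ^ 3 := by rw [card_box]; push_cast; ring
  have hn1 : (1 : ℝ) ≤ n := by exact_mod_cast hn
  calc ((Λ⟦n⟧).card : ℝ) ≤ (box 3 n).card := by exact_mod_cast h1
    _ = (2 * (n : ℝ) + 1) ^ 3 := h2
    _ ≤ (3 * (n : ℝ)) ^ 3 := pow_le_pow_left₀ (by positivity) (by linarith) 3
    _ = 27 * (n : ℝ) ^ 3 := by ring

/-- **B♯ from the truncated half-space susceptibility bound** `Σ_{y ∈ Λ_n} P_{p_c}(x ↔_ℍ y) ≤ C n^{5/2}`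
(`x ∈ Λ_n = B_n ∩ ℍ`, `n ≥ 1`): then `P^{ℍ}_{p_c,1}(|K_max(Λ_n)| ≥ 9(C+1) n^{11/4}) ≤ 1/3 ≤ e^{-1}`. -/
theorem noFatHalfBoxOrigin_of_boxSusceptibility
    (h : ∃ C : ℝ, ∀ n : ℕ, 1 ≤ n → ∀ x ∈ Λ⟦n⟧,
      ∑ y ∈ Λ⟦n⟧, (μc).real (openConnIn HS x y) ≤ C * (n : ℝ) ^ ((5 : ℝ) / 2)) :
    ∃ C : ℝ, 0 < C ∧ ∀ n : ℕ, 1 ≤ n →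
      (μ₁).real {ω | C * (n : ℝ) ^ ((11 : ℝ) / 4) ≤ (clusterMaxIn Λ⟦n⟧ ω : ℝ)} ≤ Real.exp (-1) := by
  obtain ⟨C, h⟩ := h
  obtain ⟨D, hD⟩ : ∃ D : ℝ, D = max C 0 + 1 := ⟨_, rfl⟩
  have hD1 : 1 ≤ D := by rw [hD]; linarith [le_max_right C 0]
  have hCD : C ≤ D := by rw [hD]; linarith [le_max_left C 0]
  refine ⟨9 * D, by positivity, fun n hn => ?_⟩
  have hn1 : (1 : ℝ) ≤ n := by exact_mod_cast hn
  have hn0 : (0 : ℝ) < n := by linarith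
  have hΛ : (Λ⟦n⟧).Nonempty := ⟨0, Finset.mem_filter.2 ⟨zero_mem_box 3 n, le_rfl⟩⟩
  -- the pair sum is at most `|Λ| C n^{5/2} ≤ 27 D n^{11/2}`
  have hpairs : ∑ xy ∈ Λ⟦n⟧ ×ˢ Λ⟦n⟧, (μ₁).real (openConn xy.1 xy.2) ≤ 27 * D * (n : ℝ) ^ ((11 : ℝ) / 2) := by
    rw [Finset.sum_product]
    have hx : ∀ x ∈ Λ⟦n⟧, ∑ y ∈ Λ⟦n⟧, (μ₁).real (openConn x y) ≤ D * (n : ℝ) ^ ((5 : ℝ) / 2) := by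
      intro x hx
      have hxH : x ∈ HS := (Finset.mem_filter.1 hx).2
      calc ∑ y ∈ Λ⟦n⟧, (μ₁).real (openConn x y) ≤ ∑ y ∈ Λ⟦n⟧, (μc).real (openConnIn HS x y) :=
            Finset.sum_le_sum fun y _ => real_openConn_le hxH y
        _ ≤ C * (n : ℝ) ^ ((5 : ℝ) / 2) := h n hn x hx
        _ ≤ D * (n : ℝ) ^ ((5 : ℝ) / 2) := mul_le_mul_of_nonneg_right hCD (by positivity)
    calc ∑ x ∈ Λ⟦n⟧, ∑ y ∈ Λ⟦n⟧, (μ₁).real (openConn x y)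
        ≤ ∑ x ∈ Λ⟦n⟧, D * (n : ℝ) ^ ((5 : ℝ) / 2) := Finset.sum_le_sum hx
      _ = (Λ⟦n⟧).card * (D * (n : ℝ) ^ ((5 : ℝ) / 2)) := by rw [Finset.sum_const, nsmul_eq_mul]
      _ ≤ 27 * (n : ℝ) ^ 3 * (D * (n : ℝ) ^ ((5 : ℝ) / 2)) :=
          mul_le_mul_of_nonneg_right (card_halfBox_le hn) (by positivity)
      _ = 27 * D * ((n : ℝ) ^ ((3 : ℕ) : ℝ) * (n : ℝ) ^ ((5 : ℝ) / 2)) := by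
          rw [Real.rpow_natCast]; ring
      _ = 27 * D * (n : ℝ) ^ ((11 : ℝ) / 2) := by
          rw [← Real.rpow_add hn0]; norm_num
  -- integer threshold `k = ⌈9 D n^{11/4}⌉`
  obtain ⟨k, hk⟩ : ∃ k : ℕ, k = ⌈9 * D * (n : ℝ) ^ ((11 : ℝ) / 4)⌉₊ := ⟨_, rfl⟩
  have hlam : 9 * D * (n : ℝ) ^ ((11 : ℝ) / 4) ≤ k := hk ▸ Nat.le_ceil _
  have hlampos : 0 < 9 * D * (n : ℝ) ^ ((11 : ℝ) / 4) := by positivity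
  have hkpos : (0 : ℝ) < k := hlampos.trans_le hlam
  have hsq : (81 * D ^ 2) * (n : ℝ) ^ ((11 : ℝ) / 2) ≤ (k : ℝ) ^ 2 := by
    have : (9 * D * (n : ℝ) ^ ((11 : ℝ) / 4)) ^ 2 = 81 * D ^ 2 * (n : ℝ) ^ ((11 : ℝ) / 2) := by
      rw [mul_pow, mul_pow, ← Real.rpow_natCast ((n : ℝ) ^ ((11 : ℝ) / 4)), ← Real.rpow_mul hn0.le]
      norm_num
    rw [← this]
    exact pow_le_pow_left₀ hlampos.le hlam 2
  have hmain := sq_mul_measureReal_le_sum (μ₁) Λ⟦n⟧ hΛ k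
  -- `P(K_max ≥ k) ≤ 27 D n^{11/2} / k² ≤ 27 D / (81 D²) ≤ 1/3`
  have hP : (μ₁).real {ω | k ≤ clusterMaxIn Λ⟦n⟧ ω} ≤ 1 / 3 := by
    have hk2 : (0 : ℝ) < (k : ℝ) ^ 2 := by positivity
    have h1 : (k : ℝ) ^ 2 * (μ₁).real {ω | k ≤ clusterMaxIn Λ⟦n⟧ ω} ≤ 27 * D * (n : ℝ) ^ ((11 : ℝ) / 2) :=
      hmain.trans hpairs
    have h2 : 27 * D * (n : ℝ) ^ ((11 : ℝ) / 2) ≤ (1 / 3) * (k : ℝ) ^ 2 := by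
      have hDD : D ≤ D ^ 2 := by nlinarith
      have hn5 : 0 ≤ (n : ℝ) ^ ((11 : ℝ) / 2) := by positivity
      nlinarith [mul_le_mul_of_nonneg_right hDD hn5]
    by_contra hcon
    have hcon' : 1 / 3 < (μ₁).real {ω | k ≤ clusterMaxIn Λ⟦n⟧ ω} := lt_of_not_ge hcon
    have : (1 / 3) * (k : ℝ) ^ 2 < (k : ℝ) ^ 2 * (μ₁).real {ω | k ≤ clusterMaxIn Λ⟦n⟧ ω} := by
      nlinarith
    linarith
  have h13 : (1 : ℝ) / 3 ≤ Real.exp (-1) := by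
    rw [Real.exp_neg, le_inv_comm₀ (by norm_num) (Real.exp_pos _)]
    have := Real.exp_one_lt_d9
    norm_num; linarith
  calc (μ₁).real {ω | 9 * D * (n : ℝ) ^ ((11 : ℝ) / 4) ≤ (clusterMaxIn Λ⟦n⟧ ω : ℝ)}
      ≤ (μ₁).real {ω | k ≤ clusterMaxIn Λ⟦n⟧ ω} := by
        refine measureReal_mono (fun ω hω => ?_) (measure_ne_top _ _)
        simp only [Set.mem_setOf_eq] at hω ⊢
        rw [hk]
        exact Nat.ceil_le.2 hω
    _ ≤ 1 / 3 := hP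
    _ ≤ Real.exp (-1) := h13

/-! ### Registered wrappers (def-free signatures, registered on the crux item) -/

/-- **Registered wrapper `stub_noFatOfQuantile`**: B♯ (canonical `stub_noFatHalfBoxOrigin`) from any
quantile `q < 1`; verbatim `noFatHalfBoxOrigin_of_quantile`. -/
theorem stub_noFatOfQuantile : (∃ C q : ℝ, 0 < C ∧ q < 1 ∧ ∀ n : ℕ, 1 ≤ n → (floorDilutedPercolation 3 (criticalProbI 3) 1).real {ω | C * (n : ℝ) ^ ((11 : ℝ) / 4) ≤ (clusterMaxIn ((box 3 n).filter fun z : Site 3 => 0 ≤ z 0) ω : ℝ)} ≤ q) → (∃ C : ℝ, 0 < C ∧ ∀ n : ℕ, 1 ≤ n → (floorDilutedPercolation 3 (criticalProbI 3) 1).real {ω | C * (n : ℝ) ^ ((11 : ℝ) / 4) ≤ (clusterMaxIn ((box 3 n).filter fun z : Site 3 => 0 ≤ z 0) ω : ℝ)} ≤ Real.exp (-1)) :=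
  noFatHalfBoxOrigin_of_quantile

/-- **Registered wrapper `stub_noFatOfSusceptibility`**: B♯ (canonical `stub_noFatHalfBoxOrigin`) from the
truncated half-space susceptibility bound with exponent `5/2`; verbatim
`noFatHalfBoxOrigin_of_boxSusceptibility`. -/
theorem stub_noFatOfSusceptibility : (∃ C : ℝ, ∀ n : ℕ, 1 ≤ n → ∀ x ∈ (box 3 n).filter (fun z : Site 3 => 0 ≤ z 0), ∑ y ∈ (box 3 n).filter (fun z : Site 3 => 0 ≤ z 0), (bondPercolation (zdGraph 3) (criticalProbI 3)).real (openConnIn {x : Site 3 | 0 ≤ x 0} x y) ≤ C * (n : ℝ) ^ ((5 : ℝ) / 2)) → (∃ C : ℝ, 0 < C ∧ ∀ n : ℕ, 1 ≤ n → (floorDilutedPercolation 3 (criticalProbI 3) 1).real {ω | C * (n : ℝ) ^ ((11 : ℝ) / 4) ≤ (clusterMaxIn ((box 3 n).filter fun z : Site 3 => 0 ≤ z 0) ω : ℝ)} ≤ Real.exp (-1)) :=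
  noFatHalfBoxOrigin_of_boxSusceptibility

end Summit.CriticalPhenomena.PercolationContinuityZ3.Theorems.FloorRusso.NoFatForms

end
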